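import Summits.SmoothPoincare4.SmoothPoincare4.Theses.WeylBudget
import Summits.SmoothPoincare4.SmoothPoincare4.Theorems.WeylBudgetCorkRegluingBudgetIsometricRegluingTransport
import Summits.SmoothPoincare4.Statement
import Literature.Topology.FourManifolds.ClosedBallProofs
import Literature.Geometry.Riemannian.ChangGurskyYangProofs
import HarnessLib

/-!
# `CorkRegluingBudget` follows from the summit: a restates-target certificate

Crux `Summit.SmoothPoincare4.SmoothPoincare4.Theses.WeylBudget.CorkRegluingBudget` (item
stmt-SmoothPoincare4-10831, route WeylBudget).  The route's assembly proves
`ChangGurskyYang → CorkRegluingBudget → BudgetTransfer → SmoothPoincare4`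
(`weylBudget_assembly_proof`).  This file proves the CONVERSE direction
`SmoothPoincare4 → CorkRegluingBudget` unconditionally, certifying the refuter's remark
(crux-attack 2026-08-15, "RESTATES-TARGET") that the crux carries exactly the strength of the
summit modulo Chang–Gursky–Yang's Theorem A and the proved budget transfer: for a homotopy
4-sphere `Σ` with a diffeomorphism `F : Σ ≅ S⁴`, present `S⁴ = 𝔻⁴ ∪_{id} 𝔻⁴` by the two
hemispheres (tree theorem `isDouble_sphere_holds`), take the TRIVIAL cork `C = V = 𝔻⁴`, the round
metric `g` (`R = 12 > 0`, `∫|W|² = 0 < 32π²`, `roundSphere_four_changGurskyYang_hypotheses`) and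
transport the presentation and the metric to `Σ` along `F⁻¹` (`isometricTransport`, the landed
transport step of Stub B2).  Everything here is proved; no definitions, no named facts.
-/

-- the prescribed namespace `Summit.<P>.<Sub>.…` duplicates `SmoothPoincare4` (P = Sub)
set_option linter.dupNamespace false

open scoped Manifold ContDiff Topology
-- Mathlib's scoped instance `Fact (finrank ℝ (EuclideanSpace ℝ (Fin n)) = n)`
open scoped EuclideanSpace
open Set Function

noncomputable section

namespace Summit.SmoothPoincare4.SmoothPoincare4.Theorems.CorkRegluingBudget

open Literature.Geometry.Lorentzian Literature.Geometry.Lorentzian.PseudoRiemannianMetric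
  Literature.Geometry.Riemannian Literature.Topology.FourManifolds

/-- **The crux `CorkRegluingBudget` follows from the smooth Poincaré conjecture in dimension 4**
(restates-target certificate; converse of the route's assembly modulo CGY Thm A).  Given
`Σ ≅ S⁴`, the trivial cork works: `S⁴ = 𝔻⁴ ∪_{id} 𝔻⁴` (hemispheres, `isDouble_sphere_holds`),
`C = V = 𝔻⁴` (compact, convex hence contractible), `g` the round metric, and the presentation and
metric transported to `Σ` along the diffeomorphism (`isometricTransport`). [folklore] -/
theorem corkRegluingBudget_of_smoothPoincare4 (h : _root_.SmoothPoincare4) :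
    Summit.SmoothPoincare4.SmoothPoincare4.Theses.WeylBudget.CorkRegluingBudget := by
  intro S
  -- the diffeomorphism `Σ ≅ S⁴` handed over by the summit statement
  obtain ⟨e⟩ := S.nonempty_homotopyEquiv
  have hS : ContinuousMap.HomotopyEquiv.NonemptyDiffeomorphSphere S.carrier 4 := h S.carrier
  obtain ⟨F⟩ := hS inferInstance inferInstance e
  -- `S⁴ = 𝔻⁴ ∪_{id} 𝔻⁴`
  obtain ⟨jC, jV, hjC, hjV, hcov, hseam⟩ := isDouble_sphere_holds (n := 3)
  -- the round metric: Levi-Civita, Riemannian, `R > 0`, `∫|W|² < 32π²`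
  obtain ⟨g, hLC, hg, hscal, hweyl⟩ :=
    roundSphere_four_changGurskyYang_hypotheses (EuclideanSpace ℝ (Fin 5))
  -- `Σ` is the same gluing, transported along `F⁻¹`
  have hP : IsBoundaryGluing (closedBallBoundaryData 3) (closedBallBoundaryData 3)
      (Diffeomorph.refl (𝓡 3) _ ∞) (𝓡 4) S.carrier := by
    refine ⟨F.symm ∘ jC, F.symm ∘ jV, hjC.diffeomorph_comp F.symm, hjV.diffeomorph_comp F.symm,
      ?_, fun a b ↦ ?_⟩
    · rw [range_comp, range_comp, ← image_union, hcov, image_univ]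
      exact range_eq_univ.2 F.symm.surjective
    · exact F.symm.injective.eq_iff.trans (hseam a b)
  obtain ⟨kC, kV, γ, hkC, hkV, hkcov, hkseam, hγ, hpC, hpV⟩ :=
    isometricTransport _ (closedBallBoundaryData 3) _ (closedBallBoundaryData 3)
      (Diffeomorph.refl (𝓡 3) _ ∞) _ S.carrier jC jV g hjC hjV hcov
      (fun a b ↦ hseam a b) hg hP
  haveI : ContractibleSpace (Metric.closedBall (0 : EuclideanSpace ℝ (Fin 4)) 1) :=
    (convex_closedBall (0 : EuclideanSpace ℝ (Fin 4)) 1).contractibleSpace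
      (Metric.nonempty_closedBall.2 zero_le_one)
  refine ⟨Metric.closedBall (0 : EuclideanSpace ℝ (Fin 4)) 1, inferInstance, inferInstance,
    inferInstance, Metric.closedBall (0 : EuclideanSpace ℝ (Fin 4)) 1, inferInstance, inferInstance,
    inferInstance, jC, jV, kC, kV, g, γ, inferInstance, ‹_›, hjC, hjV, hcov, ?_, hkC, hkV, hkcov, ?_,
    fun c ↦ (hpC c).symm, fun v ↦ (hpV v).symm, hg, hγ, hLC, hscal, hweyl⟩
  · intro c v hcv
    obtain ⟨z, rfl, -⟩ := (hseam c v).1 hcv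
    exact (closedBallBoundaryData 3).incl_mem_boundary z
  · intro c v hcv
    obtain ⟨z, rfl, -⟩ := (hkseam c v).1 hcv
    exact (closedBallBoundaryData 3).incl_mem_boundary z

end Summit.SmoothPoincare4.SmoothPoincare4.Theorems.CorkRegluingBudget

end
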